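import Summits.QuantumAdvantage.AdviceFreeQNC0.KernelFibration
import Mathlib.Algebra.BigOperators.Group.Finset.Basic
import HarnessLib

/-!
# Cell qa-qnc0 — the SMALL-CYLINDER LOWER BOUND for the law of the kernel line (planner qa-qnc0-p1 g19,
ROUND-18 §3.6 step (2); `exp19/Sketch19.lean` §6, def `HardcoreCylinderLB` VERBATIM)

`hardcoreCylinderLB : HardcoreCylinderLB`: there are `c₀ > 0` and `n₁` such that for every ring length
`n ≥ n₁`, every set `S` of at most `7` positions and every assignment `σ` on `S` without two cyclically
adjacent zeros inside `S`, at least `c₀·2^{n-1}` odd patterns `x` have `J(x)|_S = σ`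
(`J = kline`, the kernel line of `KernelFibration.lean`).  This is the ENGINE of the planner's rung
`AffineStakesHardOdd3` (`affineStakesHardOdd3_of`, Sketch19 §6) and of the AP-MAJ₃ toy (`apMaj3Lt_of`,
§8): every "toggle" / "cylinder event has probability Ω(1)" step of ROUND-18 §3.6 is an instance.

Proof = the planner's SURGERY, made exact over `card_fibre` (`#{x odd : J(x) = v} = 2^{Z(v)-1}`):
with `W = S ∪ N(S)` (`|W| ≤ 21`) and `Φ(v) :=` (`σ` on `S`, `1` on `W ∖ S`, `v` off `W`)
(`surgery`), `Φ(v)` is hard-core (`hardCore_surgery`), `Z(v) ≤ Z(Φ v) + |W|`, `Φ` is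
`≤ 2^{|W|}`-to-one and `Φ(v)|_S = σ`; summing fibrewise,
`#{x odd : J(x) has a zero off W} ≤ 4^{|W|} · #{x odd : J(x)|_S = σ}`, while the residual odd patterns
(all zeros of `J(x)` inside `W`) vanish off `N(W)` by the forcing equations, so number `≤ 2^{63}`;
with `#{x odd} = 2^{n-1}` (`card_isOdd`) this gives `c₀ = 2^{-43}`, `n₁ = 65` (constants immaterial).

WHAT THIS IS NOT: no strategy bound; `HardcoreToggle`, `AffineStakesHardOdd3` not proved here; crux 22907
untouched; separation NOT moved.
-/

namespace Summit.QuantumAdvantage.AdviceFreeQNC0.Fib19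

open Finset Literature.Computability.QuantumComplexity Literature.Computability.QuantumComplexity.RingHLF

variable {n : ℕ}

/-! ### Statement (Sketch19 §6, verbatim) -/

/-- ENGINE for steps (2), (4a)–(4c) of ROUND-18 §3.6: SMALL-CYLINDER LOWER BOUND for the law of `J`.  For
any ≤ 7 positions `S` and any assignment `σ` on `S` with no two cyclically adjacent zeros, at least
`c·2^{n-1}` odd patterns have `J|_S = σ` (`c > 0` absolute).  (Sketch19 §6 `HardcoreCylinderLB`, verbatim.) -/
def HardcoreCylinderLB : Prop :=
  open scoped Classical in
  ∃ c₀ : ℝ, 0 < c₀ ∧ ∃ n₁ : ℕ, ∀ n ≥ n₁, ∀ S : Finset (Fin n), S.card ≤ 7 → ∀ σ : Fin n → Bool,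
    (∀ i ∈ S, nxt i ∈ S → ¬ (σ i = false ∧ σ (nxt i) = false)) →
      c₀ * (2 : ℝ) ^ (n - 1) ≤
        ((univ.filter fun x : Fin n → Bool => OddZeros x ∧ ∀ i ∈ S, kline x i = σ i).card : ℝ)

/-! ### Neighbourhoods and the surgery map -/

/-- Closed neighbourhood `S ∪ N(S)` of a set of positions on the cycle. -/
def nbhd (S : Finset (Fin n)) : Finset (Fin n) := S ∪ (S.image prv ∪ S.image nxt)

/-- `S ⊆ nbhd S`. -/
theorem subset_nbhd (S : Finset (Fin n)) : S ⊆ nbhd S := subset_union_left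

/-- `nxt i ∈ nbhd S` for `i ∈ S`. -/
theorem nxt_mem_nbhd {S : Finset (Fin n)} {i : Fin n} (h : i ∈ S) : nxt i ∈ nbhd S :=
  mem_union_right _ (mem_union_right _ (mem_image_of_mem _ h))

/-- `prv i ∈ nbhd S` for `i ∈ S`. -/
theorem prv_mem_nbhd {S : Finset (Fin n)} {i : Fin n} (h : i ∈ S) : prv i ∈ nbhd S :=
  mem_union_right _ (mem_union_left _ (mem_image_of_mem _ h))

/-- If `nxt b ∈ S` then `b ∈ nbhd S`. -/
theorem mem_nbhd_of_nxt_mem {S : Finset (Fin n)} {b : Fin n} (h : nxt b ∈ S) : b ∈ nbhd S := by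
  rw [← prv_nxt b]; exact prv_mem_nbhd h

/-- If `prv b ∈ S` then `b ∈ nbhd S`. -/
theorem mem_nbhd_of_prv_mem {S : Finset (Fin n)} {b : Fin n} (h : prv b ∈ S) : b ∈ nbhd S := by
  rw [← nxt_prv b]; exact nxt_mem_nbhd h

/-- `|nbhd S| ≤ 3|S|`. -/
theorem card_nbhd_le (S : Finset (Fin n)) : (nbhd S).card ≤ 3 * S.card := by
  unfold nbhd
  calc _ ≤ S.card + (S.image prv ∪ S.image nxt).card := card_union_le _ _
    _ ≤ S.card + ((S.image prv).card + (S.image nxt).card) := by gcongr; exact card_union_le _ _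
    _ ≤ S.card + (S.card + S.card) :=
        Nat.add_le_add_left (Nat.add_le_add card_image_le card_image_le) _
    _ = 3 * S.card := by ring

/-- The surgery: impose `τ` on `W`, keep `v` off `W`. -/
def surgery (W : Finset (Fin n)) (τ v : Fin n → Bool) : Fin n → Bool :=
  fun i => if i ∈ W then τ i else v i

/-- The surgery on `W`. -/
theorem surgery_of_mem {W : Finset (Fin n)} {τ v : Fin n → Bool} {i : Fin n} (h : i ∈ W) :
    surgery W τ v i = τ i := if_pos h

/-- The surgery off `W`. -/
theorem surgery_of_not_mem {W : Finset (Fin n)} {τ v : Fin n → Bool} {i : Fin n} (h : i ∉ W) :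
    surgery W τ v i = v i := if_neg h

/-- **The surgery preserves hard-core configurations.** With `W = nbhd S` and `τ = (σ on S, 1 on W ∖ S)`,
`σ` without two adjacent zeros inside `S`: `Φ(v)` is hard-core for every hard-core `v` with a zero off `W`. -/
theorem hardCore_surgery (S : Finset (Fin n)) (σ : Fin n → Bool)
    (hσ : ∀ i ∈ S, nxt i ∈ S → ¬ (σ i = false ∧ σ (nxt i) = false))
    (v : Fin n → Bool) (hv : HardCore v) {b : Fin n} (hbW : b ∉ nbhd S) (hb : v b = false) :
    HardCore (surgery (nbhd S) (fun i => if i ∈ S then σ i else true) v) := by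
  have hτS : ∀ i, (fun i => if i ∈ S then σ i else true) i = false → i ∈ S ∧ σ i = false := by
    intro i hi
    by_cases h : i ∈ S
    · simp only [h, if_true] at hi; exact ⟨h, hi⟩
    · simp only [h, if_false] at hi; exact absurd hi (by decide)
  constructor
  · rintro i ⟨h0, h1⟩
    by_cases hiW : i ∈ nbhd S
    · rw [surgery_of_mem hiW] at h0
      obtain ⟨hiS, hσi⟩ := hτS i h0
      rw [surgery_of_mem (nxt_mem_nbhd hiS)] at h1
      obtain ⟨hnS, hσn⟩ := hτS _ h1
      exact hσ i hiS hnS ⟨hσi, hσn⟩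
    · rw [surgery_of_not_mem hiW] at h0
      by_cases hnW : nxt i ∈ nbhd S
      · rw [surgery_of_mem hnW] at h1
        obtain ⟨hnS, -⟩ := hτS _ h1
        exact hiW (mem_nbhd_of_nxt_mem hnS)
      · rw [surgery_of_not_mem hnW] at h1
        exact hv.1 i ⟨h0, h1⟩
  · refine ⟨nxt b, ?_⟩
    by_cases hnW : nxt b ∈ nbhd S
    · rw [surgery_of_mem hnW]
      have hnS : nxt b ∉ S := fun h => hbW (mem_nbhd_of_nxt_mem h)
      simp [hnS]
    · rw [surgery_of_not_mem hnW]; exact hv.nxt_eq_true hb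

/-- The surgery loses at most `|W|` zeros. -/
theorem zeros_le_zeros_surgery_add (W : Finset (Fin n)) (τ v : Fin n → Bool) :
    zeros v ≤ zeros (surgery W τ v) + W.card := by
  unfold zeros
  calc _ ≤ ((univ.filter fun i : Fin n => surgery W τ v i = false) ∪ W).card := by
        refine card_le_card fun i hi => ?_
        rw [mem_filter] at hi
        rw [mem_union, mem_filter]
        by_cases h : i ∈ W
        · exact Or.inr h
        · exact Or.inl ⟨mem_univ _, by rw [surgery_of_not_mem h]; exact hi.2⟩
    _ ≤ _ := card_union_le _ _

/-- Vectors prescribed off `V` number at most `2^{|V|}` (inject into the power set of `V`). -/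
theorem card_le_two_pow_of_eq_off (V : Finset (Fin n)) (g : Fin n → Bool) (s : Finset (Fin n → Bool))
    (hs : ∀ u ∈ s, ∀ b, b ∉ V → u b = g b) : s.card ≤ 2 ^ V.card := by
  rw [← card_powerset]
  refine card_le_card_of_injOn (fun u => V.filter fun i => u i = true) ?_ ?_
  · intro u _
    exact mem_coe.2 (mem_powerset.2 (filter_subset _ _))
  · intro u hu u' hu' h
    funext b
    by_cases hb : b ∈ V
    · have h1 : b ∈ V.filter (fun i => u i = true) ↔ b ∈ V.filter (fun i => u' i = true) := by
        simp only at h; rw [h]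
      simp only [mem_filter, hb, true_and] at h1
      rw [Bool.eq_iff_iff]; exact h1
    · rw [hs u hu b hb, hs u' hu' b hb]

/-! ### Fibre bookkeeping -/

/-- Upper bound for every fibre: `#{x odd : J(x) = v} ≤ 2^{Z(v)}` (empty unless `v` is hard-core, then a
subset of `{x : v ∈ K(x)}`, `card_filter_inKernel`). -/
theorem card_fibre_le (hn : 3 ≤ n) (v : Fin n → Bool) :
    (univ.filter fun x : Fin n → Bool => IsOdd x ∧ kline x = v).card ≤ 2 ^ zeros v := by
  rcases (univ.filter fun x : Fin n → Bool => IsOdd x ∧ kline x = v).eq_empty_or_nonempty with h | ⟨x₀, hx₀⟩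
  · rw [h, card_empty]; exact Nat.zero_le _
  · rw [mem_filter] at hx₀
    obtain ⟨-, ho, hk⟩ := hx₀
    have hv : HardCore v := hk ▸ kline_hardCore hn x₀ ho
    rw [← card_filter_inKernel v hv.1]
    refine card_le_card fun x hx => ?_
    rw [mem_filter] at hx ⊢
    exact ⟨mem_univ _, hx.2.2 ▸ kline_inKernel hn x hx.2.1⟩

/-- Exactly half of all patterns are odd: `#{x : IsOdd x} = 2^{n-1}` (`n ≥ 1`; one-coin involution). -/
theorem card_isOdd (hn : 1 ≤ n) : (univ.filter fun x : Fin n → Bool => IsOdd x).card = 2 ^ (n - 1) := by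
  obtain ⟨m, rfl⟩ : ∃ m, n = m + 1 := ⟨n - 1, by omega⟩
  have h := two_mul_card_filter_of_invol (univ : Finset (Fin (m + 1) → Bool)) (fun x => IsOdd x)
    (fun x => flipAt x {(0 : Fin (m + 1))}) (fun x _ => mem_univ _) (fun x _ => flipAt_flipAt x _)
    (fun x _ => isOdd_flipAt_of_odd x _ (by rw [card_singleton]))
  rw [card_univ, Fintype.card_fun, Fintype.card_bool, Fintype.card_fin, pow_succ'] at h
  rw [Nat.add_sub_cancel]
  exact Nat.eq_of_mul_eq_mul_left two_pos h

/-- The residual patterns: if every zero of `J(x)` lies in `W`, then `x` vanishes off `nbhd W` (forcing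
equations `x_b = J_{b-1} ⊕ J_{b+1} = 1 ⊕ 1`). -/
theorem apply_eq_false_of_zeros_subset (hn : 3 ≤ n) (W : Finset (Fin n)) (x : Fin n → Bool) (hodd : IsOdd x)
    (hW : ∀ b, b ∉ W → kline x b = true) (b : Fin n) (hb : b ∉ nbhd W) : x b = false := by
  have h0 : b ∉ W := fun h => hb (subset_nbhd W h)
  have h1 : prv b ∉ W := fun h => hb (mem_nbhd_of_prv_mem h)
  have h2 : nxt b ∉ W := fun h => hb (mem_nbhd_of_nxt_mem h)
  rw [apply_eq_of_kline hn x hodd b (hW b h0), hW _ h1, hW _ h2]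
  rfl

/-! ### The theorem -/

/-- **`HardcoreCylinderLB` holds** (with `c₀ = 2^{-43}`, `n₁ = 65`): the surgery argument of ROUND-18 §3.6
step (2), over the fibre count `card_fibre`. -/
theorem hardcoreCylinderLB : HardcoreCylinderLB := by
  classical
  refine ⟨1 / 2 ^ 43, by positivity, 65, fun n hn S hS σ hσ => ?_⟩
  have hn3 : 3 ≤ n := by omega
  -- the objects
  set W := nbhd S with hWdef
  have hWcard : W.card ≤ 21 := (card_nbhd_le S).trans (by omega)
  have hNWcard : (nbhd W).card ≤ 63 := (card_nbhd_le W).trans (by omega)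
  set τ : Fin n → Bool := fun i => if i ∈ S then σ i else true with hτ
  set Φ : (Fin n → Bool) → (Fin n → Bool) := surgery W τ with hΦ
  have hΦS : ∀ v, ∀ i ∈ S, Φ v i = σ i := fun v i hi => by
    rw [hΦ, surgery_of_mem (subset_nbhd S hi), hτ]; exact if_pos hi
  have hΦout : ∀ v b, b ∉ W → Φ v b = v b := fun v b hb => surgery_of_not_mem hb
  -- fibres
  set fib : (Fin n → Bool) → Finset (Fin n → Bool) :=
    fun v => univ.filter fun x : Fin n → Bool => IsOdd x ∧ kline x = v with hfib
  set A : Finset (Fin n → Bool) :=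
    univ.filter fun v : Fin n → Bool => HardCore v ∧ ∃ b, b ∉ W ∧ v b = false with hA
  set T : Finset (Fin n → Bool) :=
    univ.filter fun x : Fin n → Bool => IsOdd x ∧ ∀ i ∈ S, kline x i = σ i with hT
  -- (1) pointwise comparison on `A`
  have hpt : ∀ v ∈ A, (fib v).card ≤ 2 ^ W.card * (fib (Φ v)).card := by
    intro v hv
    rw [hA, mem_filter] at hv
    obtain ⟨-, hvc, b, hbW, hb⟩ := hv
    have hz : 0 < zeros v := card_pos.2 ⟨b, mem_filter.2 ⟨mem_univ _, hb⟩⟩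
    have hvc' : HardCore (Φ v) := hardCore_surgery S σ hσ v hvc hbW hb
    have hz' : 0 < zeros (Φ v) :=
      card_pos.2 ⟨b, mem_filter.2 ⟨mem_univ _, by rw [hΦout v b hbW]; exact hb⟩⟩
    rw [hfib]
    simp only
    rw [card_fibre hn3 v hvc hz, card_fibre hn3 (Φ v) hvc' hz', ← pow_add]
    apply Nat.pow_le_pow_right two_pos
    have hzz := zeros_le_zeros_surgery_add W τ v
    rw [← hΦ] at hzz
    omega
  -- (2) the fibres of `Φ` on `A` have size `≤ 2^{|W|}`
  have hfibre : ∀ v', (A.filter fun v => Φ v = v').card ≤ 2 ^ W.card := by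
    intro v'
    refine card_le_two_pow_of_eq_off W v' _ fun u hu b hb => ?_
    rw [mem_filter] at hu
    rw [← hu.2, hΦout u b hb]
  -- (3) the images lie in `T`, fibrewise
  have himg : ∀ v' ∈ A.image Φ, fib v' = T.filter fun x => kline x = v' := by
    intro v' hv'
    rw [mem_image] at hv'
    obtain ⟨v, -, rfl⟩ := hv'
    rw [hfib, hT]
    ext x
    simp only [mem_filter, mem_univ, true_and]
    constructor
    · rintro ⟨ho, hk⟩; exact ⟨⟨ho, fun i hi => by rw [hk, hΦS v i hi]⟩, hk⟩
    · rintro ⟨⟨ho, -⟩, hk⟩; exact ⟨ho, hk⟩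
  -- (4) the main chain on `A`
  have hchain : ∑ v ∈ A, (fib v).card ≤ 2 ^ W.card * 2 ^ W.card * T.card := by
    calc ∑ v ∈ A, (fib v).card ≤ ∑ v ∈ A, 2 ^ W.card * (fib (Φ v)).card := sum_le_sum hpt
      _ = 2 ^ W.card * ∑ v ∈ A, (fib (Φ v)).card := by rw [mul_sum]
      _ = 2 ^ W.card * ∑ v' ∈ A.image Φ, (A.filter fun v => Φ v = v').card * (fib v').card := by
          rw [Finset.sum_comp (fun v' => (fib v').card) Φ]; simp only [smul_eq_mul]
      _ ≤ 2 ^ W.card * ∑ v' ∈ A.image Φ, 2 ^ W.card * (fib v').card := by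
          gcongr with v' hv'
          exact hfibre v'
      _ = 2 ^ W.card * 2 ^ W.card * ∑ v' ∈ A.image Φ, (fib v').card := by rw [← mul_sum, mul_assoc]
      _ = 2 ^ W.card * 2 ^ W.card * ∑ v' ∈ A.image Φ, (T.filter fun x => kline x = v').card := by
          rw [sum_congr rfl fun v' hv' => by rw [himg v' hv']]
      _ ≤ 2 ^ W.card * 2 ^ W.card * T.card := by
          gcongr
          rw [sum_card_fiberwise_eq_card_filter]
          exact card_le_card (filter_subset _ _)
  -- (5) split the odd class along `J(x) ∈ A`
  set O := univ.filter fun x : Fin n → Bool => IsOdd x with hO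
  have hO1 : (O.filter fun x => kline x ∈ A).card = ∑ v ∈ A, (fib v).card := by
    rw [card_eq_sum_card_fiberwise (f := kline) (t := A) (by intro x hx; exact (mem_filter.1 hx).2)]
    refine sum_congr rfl fun v hv => ?_
    rw [hfib, hO]
    congr 1
    ext x
    simp only [mem_filter, mem_univ, true_and]
    constructor
    · rintro ⟨⟨ho, -⟩, hk⟩; exact ⟨ho, hk⟩
    · rintro ⟨ho, hk⟩; exact ⟨⟨ho, hk.symm ▸ hv⟩, hk⟩
  have hO2 : (O.filter fun x => ¬ kline x ∈ A).card ≤ 2 ^ (nbhd W).card := by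
    refine card_le_two_pow_of_eq_off (nbhd W) (fun _ => false) _ fun x hx b hb => ?_
    rw [mem_filter, hO, mem_filter, hA, mem_filter] at hx
    obtain ⟨⟨-, ho⟩, hnot⟩ := hx
    refine apply_eq_false_of_zeros_subset hn3 W x ho (fun b' hb' => ?_) b hb
    by_contra hfalse
    exact hnot ⟨mem_univ _, kline_hardCore hn3 x ho, b', hb', by simpa using hfalse⟩
  have hOcard : O.card = 2 ^ (n - 1) := card_isOdd (by omega)
  have hsplit := Finset.card_filter_add_card_filter_not (s := O) (fun x => kline x ∈ A)
  -- (6) arithmetic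
  have h42 : 2 ^ W.card * 2 ^ W.card ≤ 2 ^ 42 := by
    rw [← pow_add]; exact Nat.pow_le_pow_right two_pos (by omega)
  have h63 : 2 ^ (nbhd W).card ≤ 2 ^ 63 := Nat.pow_le_pow_right two_pos hNWcard
  have h64 : 2 ^ 64 ≤ 2 ^ (n - 1) := Nat.pow_le_pow_right two_pos (by omega)
  have hnat : 2 ^ (n - 1) ≤ 2 ^ 43 * T.card := by
    have h1 : 2 ^ (n - 1) ≤ 2 ^ 42 * T.card + 2 ^ 63 := by
      calc 2 ^ (n - 1) = O.card := hOcard.symm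
        _ = (O.filter fun x => kline x ∈ A).card + (O.filter fun x => ¬ kline x ∈ A).card := hsplit.symm
        _ ≤ 2 ^ W.card * 2 ^ W.card * T.card + 2 ^ (nbhd W).card := by rw [hO1]; exact add_le_add hchain hO2
        _ ≤ 2 ^ 42 * T.card + 2 ^ 63 := by gcongr
    have h2 : (2 : ℕ) ^ 64 = 2 * 2 ^ 63 := by norm_num
    have h3 : (2 : ℕ) ^ 43 = 2 * 2 ^ 42 := by norm_num
    omega
  -- (7) transfer to the statement
  have hTT : T.card = (univ.filter fun x : Fin n → Bool => OddZeros x ∧ ∀ i ∈ S, kline x i = σ i).card := by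
    rw [hT]
    congr 1
    exact filter_congr fun x _ => by rw [isOdd_iff_oddZeros]
  rw [← hTT]
  have hreal : (2 : ℝ) ^ (n - 1) ≤ 2 ^ 43 * (T.card : ℝ) := by exact_mod_cast hnat
  calc 1 / 2 ^ 43 * (2 : ℝ) ^ (n - 1) ≤ 1 / 2 ^ 43 * (2 ^ 43 * (T.card : ℝ)) := by gcongr
    _ = (T.card : ℝ) := by field_simp

end Summit.QuantumAdvantage.AdviceFreeQNC0.Fib19
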